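import Summits.Ventures.CertifiedArithmetic.LowPrec.DoubleRoundingFMALadder

/-!
# Double rounding of the FMA — every binade above `W` decided exactly (THEOREM D-fma-M∞): the
# slip frame

HONEST FRAMING: certified error envelopes and provably optimal rounding/accumulation schemes for
low-precision formats under stated cost models; every table by two implementations; no hardware
or vendor claims.

Soundness of `fmaLadderTest` (`DoubleRoundingFMALadder.lean`): under the grid conditions of
THEOREM D-fma-M with `n ≥ m + 2`, a source maximum `M = (2^m + J)·2^(k+i+1)` quanta in the binade
`i` above `W = 2^(m+1+k)·quantum φ` and the window condition `i + 2 ≤ m + bias φ` (window A of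
`slip_in_windows` is empty: `M ≤ 2^(m_ψ+1)·quantum φ`), every slip of `fl_φ ∘ fl_ψ` at a positive
`a·b + c` (`a·b ≠ 0`) is read back into the test (`ladder_slip_sig`).  THE FRAME: `fl_ψ (a·b + c)`
is a midpoint `μ_t = (2t+1)·2^(k+i')·quantum φ` of some binade `i' ≤ i` (`slip_midpoint_of_pos`),
`t + 1` visible; the register's spacing there is `2^(i'+1)·quantum φ²` and `a·b`, `c` are multiples
of `quantum φ²`, so `a·b + c = μ_t + N·quantum φ²` with `0 < |N| ≤ 2^i'`, and the two
`φ`-roundings of `μ_t` and of `μ_t ∓ δ` (far side, `δ < 2^(k+i')·quantum φ`) agree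
(`toRat_roundNE_gmid[_odd]`, `toRat_roundNE_below/above_gmid`), forcing `N > 0` for `t` even,
`N < 0` for `t` odd; the rest is integer bookkeeping (`ladder_core`).  §2 builds, conversely, the
datum of a passing candidate (`exists_ladder_data`: `a = a₁·2^(i'-g)`, `b = ±b₁`,
`c = w·2^(k+i')` quanta).  The decision, the universal cap and the instances are in
`DoubleRoundingFMALadderIff.lean` / `…LadderTable.lean`; implementation A:
`code/enum/fma_ladder_law.py` → `DOUBLE-ROUNDING-FMA.md` §15.  PLACEMENT: the midpoint property
[MartinDorelMelquiondMuller2013] Property 2.1; innocuous double rounding [Figueroa1995] §3,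
[Roux2014] §2.  No hardware or vendor claims.
-/

namespace Summit.Ventures.CertifiedArithmetic

open Literature.ComputerArithmetic.FloatingPoint
open Literature.ComputerArithmetic.FloatingPoint.Format
open Literature.ComputerArithmetic.FloatingPoint.MiniFloat

/-! ## §1 The slip frame on every binade above `W` -/

/-- THE FRAME OF A SLIP ABOVE `W` (soundness of the ladder test).  Grids nested,
`2 P_φ ≤ P_ψ`, `bias φ ≤ bias ψ`, `L_ψ ≤ 2 L_φ`, `L_ψ + P_ψ ≤ L_φ`, `m ≥ 1`, `bias φ ≥ 1`,
`m_ψ = m + n`, `n ≥ m + 2`, `k + m + bias φ = n + 1`, `M_φ = (2^m + J)·2^(k+i+1)` with `J ≤ 2^m`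
and `i + 2 ≤ m + bias φ`: a slip of `fl_φ ∘ fl_ψ` at `a·b + c > 0` (`a·b ≠ 0`) passes
`fmaLadderTest m n i J`. [cite: MartinDorelMelquiondMuller2013, Property 2.1] -/
theorem ladder_slip_sig {φ ψ : Format} (hE : embedsTest φ ψ = true)
    (hm : 2 * φ.manBits + 1 ≤ ψ.manBits) (hbias : φ.bias ≤ ψ.bias) (hq2 : ψ.qexp ≤ 2 * φ.qexp)
    (hnorm : ψ.qexp + ψ.manBits + 1 ≤ φ.qexp) (h1 : 1 ≤ φ.manBits) (hb : 1 ≤ φ.bias)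
    {n k i J : ℕ} (hn : ψ.manBits = φ.manBits + n) (hn2 : φ.manBits + 2 ≤ n)
    (hk : k + (φ.manBits + φ.bias) = n + 1) (hJ : J ≤ 2 ^ φ.manBits)
    (hiA : i + 2 ≤ φ.manBits + φ.bias)
    (hM : φ.maxScaled = (2 ^ φ.manBits + J) * 2 ^ (k + i + 1))
    {a b c : MiniFloat φ} (ha : a.scaledMag ≠ 0) (hb0 : b.scaledMag ≠ 0)
    (hx : 0 < a.toRat * b.toRat + c.toRat)
    (h : (roundNE φ (roundNE ψ (a.toRat * b.toRat + c.toRat)).toRat).toRat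
      ≠ (roundNE φ (a.toRat * b.toRat + c.toRat)).toRat) :
    fmaLadderTest φ.manBits n i J = true := by
  set x := a.toRat * b.toRat + c.toRat with hxdef
  have hQφ := φ.quantum_pos
  have hQψ := ψ.quantum_pos
  have hqq : 0 < φ.quantum * φ.quantum := mul_pos hQφ hQφ
  have hq : ψ.qexp ≤ φ.qexp := by omega
  -- (1) the windows and the midpoint anatomy
  obtain ⟨hymax, hwin⟩ := slip_in_windows hE hm hbias hq2 hnorm ha hb0 hx h
  obtain ⟨zM, hzM⟩ := exists_toRat_eq_maxRat_of_test hE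
  have hmax : φ.maxRat ≤ ψ.maxRat := hzM ▸ (le_abs_self _).trans (abs_toRat_le_maxRat zM)
  obtain ⟨v, u, hv0, hvx, hxu, hgap, hmid, hxm⟩ :=
    slip_midpoint_of_pos (by omega) hbias hmax hx h
  set y := roundNE ψ x with hydef
  obtain ⟨u', hu'⟩ := exists_toRat_eq_add_ulp hv0 (hvx.trans hxu)
  have hueq : u.toRat = v.toRat + 2 ^ (v.expCode - 1) * φ.quantum := by
    have hule := add_ulp_le_of_lt hv0 (hvx.trans hxu)
    have hGpos : (0:ℚ) < 2 ^ (v.expCode - 1) * φ.quantum := by positivity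
    rcases hgap u' with h0 | h0 <;> linarith
  have humax : u.toRat ≤ φ.maxRat := (le_abs_self _).trans (abs_toRat_le_maxRat u)
  have hyu : y.toRat < u.toRat := by rw [hmid]; linarith
  have hvy : v.toRat < y.toRat := by rw [hmid]; linarith
  have hy0 : 0 < y.toRat := lt_of_le_of_lt hv0 hvy
  -- (2) units: `2^n·q = 2^k`, `Q·q = 1` (`Q = 2^s`, `s = m + bias - 1`), `W = 2^(m+1+k)·q`
  set s := φ.manBits + (φ.bias - 1) with hsdef
  have hks : k + s = n := by omega
  have hkey : (2 : ℚ) ^ n * φ.quantum = 2 ^ k := by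
    rw [← hks, pow_add, mul_assoc, two_pow_mul_quantum_eq_one hb, mul_one]
  have hQq : (2 : ℚ) ^ s * φ.quantum = 1 := two_pow_mul_quantum_eq_one hb
  have hWz : (2 : ℚ) ^ ((ψ.manBits : ℤ) + 1 + 2 * φ.qexp)
      = 2 ^ (φ.manBits + 1 + k) * φ.quantum := by
    unfold Format.quantum
    rw [← zpow_natCast, ← zpow_add₀ two_ne_zero]
    congr 1
    unfold Format.qexp; push_cast; omega
  -- (3) `W ≤ y` (window A is empty since `k + i + 1 ≤ n`; window B starts at `W`)
  have hMpow : (2 ^ φ.manBits + J) * 2 ^ (k + i + 1) ≤ 2 ^ (φ.manBits + (k + i + 2)) :=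
    calc (2 ^ φ.manBits + J) * 2 ^ (k + i + 1)
        ≤ (2 ^ φ.manBits + 2 ^ φ.manBits) * 2 ^ (k + i + 1) := Nat.mul_le_mul_right _ (by omega)
      _ = 2 ^ (φ.manBits + (k + i + 2)) := by
          rw [← mul_two, ← pow_succ, ← pow_add]; congr 1; omega
  have hWy : (2 : ℚ) ^ (φ.manBits + 1 + k) * φ.quantum ≤ y.toRat := by
    rcases hwin with hA | ⟨-, hB⟩
    · exfalso
      have h2 : φ.maxRat ≤ (2 : ℚ) ^ (ψ.manBits + 1) * φ.quantum := by
        unfold Format.maxRat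
        have h3 : φ.maxScaled ≤ 2 ^ (ψ.manBits + 1) :=
          (hM ▸ hMpow).trans (Nat.pow_le_pow_right (by norm_num) (by omega))
        have h4 : (φ.maxScaled : ℚ) ≤ 2 ^ (ψ.manBits + 1) := by exact_mod_cast h3
        exact mul_le_mul_of_nonneg_right h4 hQφ.le
      linarith
    · rwa [hWz] at hB
  -- (4) `W ≤ v`
  have hWle : 2 ^ φ.manBits * 2 ^ (k + 1) ≤ φ.maxScaled := by
    rw [hM]
    exact Nat.mul_le_mul (Nat.le_add_right _ _) (Nat.pow_le_pow_right (by norm_num) (by omega))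
  have hWrep : φ.Representable (2 ^ φ.manBits * 2 ^ (k + 1)) :=
    representable_mul_pow (Nat.pow_lt_pow_right (by norm_num) (by omega)) hWle
  obtain ⟨w0, hw0⟩ := exists_toRat_eq_natMul hWrep
  have hw0' : w0.toRat = 2 ^ (φ.manBits + 1 + k) * φ.quantum := by
    rw [hw0]; push_cast; simp only [pow_add, pow_one]; ring
  have hWv : (2 : ℚ) ^ (φ.manBits + 1 + k) * φ.quantum ≤ v.toRat := by
    rcases hgap w0 with h0 | h0
    · rwa [hw0'] at h0
    · rw [hw0'] at h0; linarith
  -- (5) `v = t·2^(k+i'+1)` in binade `i' ≤ i`, `2^m ≤ t < 2^(m+1)`, `t + 1` visible,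
  -- `y = (2t+1)·2^(k+i')` (quanta of `φ`)
  have hvQ : v.toRat = (v.scaledMag : ℚ) * φ.quantum := by
    rw [toRat_eq_toInt_mul, toInt_eq_scaledMag_of_nonneg hv0]; push_cast; rfl
  have hVlo : 2 ^ (φ.manBits + 1 + k) ≤ v.scaledMag := by
    have : ((2 ^ (φ.manBits + 1 + k) : ℕ) : ℚ) * φ.quantum ≤ (v.scaledMag : ℚ) * φ.quantum := by
      rw [← hvQ]; push_cast; exact hWv
    exact_mod_cast le_of_mul_le_mul_right this hQφ
  have hVhi : v.scaledMag < (2 ^ φ.manBits + J) * 2 ^ (k + i + 1) := by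
    have : (v.scaledMag : ℚ) * φ.quantum
        < (((2 ^ φ.manBits + J) * 2 ^ (k + i + 1) : ℕ) : ℚ) * φ.quantum := by
      rw [← hvQ, ← hM]; exact lt_of_lt_of_le (hvx.trans hxu) humax
    exact_mod_cast lt_of_mul_lt_mul_right this hQφ.le
  have hev1 : k + 1 ≤ v.expCode - 1 := succ_le_ulpExp_of_le_scaledMag hVlo
  have hev2 : v.expCode - 1 ≤ k + i + 1 := by
    have h4 := pow_le_scaledMag_of_expCode_pos v (by omega)
    have h5 := (Nat.pow_lt_pow_iff_right (by norm_num)).mp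
      (h4.trans_lt (hVhi.trans_le hMpow))
    omega
  obtain ⟨i', hi'⟩ : ∃ i', v.expCode - 1 = k + i' + 1 := ⟨v.expCode - 1 - (k + 1), by omega⟩
  have hi'i : i' ≤ i := by omega
  obtain ⟨t, ht⟩ : ∃ t, v.scaledMag = t * 2 ^ (k + i' + 1) := by
    obtain ⟨c', hc'⟩ := pow_ulpExp_dvd_scaledMag v
    exact ⟨c', by rw [hc', hi', mul_comm]⟩
  have htlo : 2 ^ φ.manBits ≤ t := by
    have h4 := pow_le_scaledMag_of_expCode_pos v (by omega)
    rw [hi', ht, pow_add 2 φ.manBits (k + i' + 1)] at h4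
    exact Nat.le_of_mul_le_mul_right h4 (by positivity)
  have hthi : t < 2 ^ (φ.manBits + 1) := by
    have h4 := scaledMag_lt_pow_ulpExp v
    rw [hi', ht, pow_add 2 (φ.manBits + 1) (k + i' + 1)] at h4
    exact Nat.lt_of_mul_lt_mul_right h4
  have huQ : u.toRat = (((t + 1) * 2 ^ (k + i' + 1) : ℕ) : ℚ) * φ.quantum := by
    rw [hueq, hvQ, ht, hi']; push_cast; ring
  have hu1 : (t + 1) * 2 ^ (k + i' + 1) ≤ φ.maxScaled := by
    have : (((t + 1) * 2 ^ (k + i' + 1) : ℕ) : ℚ) * φ.quantum ≤ (φ.maxScaled : ℚ) * φ.quantum := by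
      rw [← huQ]; exact humax
    exact_mod_cast le_of_mul_le_mul_right this hQφ
  have hvis : (t + 1) * 2 ^ (k + i' + 1) ≤ (2 ^ φ.manBits + J) * 2 ^ (k + i + 1) := hM ▸ hu1
  have hyg : y.toRat = (((2 * t + 1) * 2 ^ (k + i') : ℕ) : ℚ) * φ.quantum := by
    rw [hmid, hueq, hvQ, ht, hi']; push_cast; ring
  -- (6) `|x - y| ≤ 2^i'·quantum φ²` (the spacing of `ψ` on binade `i'` is `2^(i'+1)·quantum φ²`)
  set D := (φ.qexp - ψ.qexp).toNat with hDdef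
  have hDq : φ.quantum = 2 ^ D * ψ.quantum := quantum_eq_two_pow_mul hq
  have hD0 : ((D : ℕ) : ℤ) = φ.qexp - ψ.qexp := Int.toNat_of_nonneg (by omega)
  set S := (2 * φ.qexp - ψ.qexp).toNat with hSdef
  have hS0 : ((S : ℕ) : ℤ) = 2 * φ.qexp - ψ.qexp := Int.toNat_of_nonneg (by omega)
  have hSq : φ.quantum * φ.quantum = 2 ^ S * ψ.quantum := by
    unfold Format.quantum
    rw [← zpow_natCast, ← zpow_add₀ two_ne_zero, ← zpow_add₀ two_ne_zero, hS0]
    congr 1; ring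
  have hkDS : k + D = n + S := by unfold Format.qexp at hD0 hS0; omega
  have habs : |x - y.toRat| ≤ 2 ^ i' * (φ.quantum * φ.quantum) := by
    have hyz : y.toRat < zM.toRat := by rw [hzM]; exact hymax
    have h0 := abs_sub_roundNE_le_half_ulp_of_pos hy0 hyz
    have hexp : y.expCode - 1 ≤ S + 1 + i' := by
      rcases Nat.lt_or_ge y.expCode 1 with h00 | hE1
      · omega
      · have h3 := pow_le_scaledMag_of_expCode_pos y hE1
        have hyQ : y.toRat = (y.scaledMag : ℚ) * ψ.quantum := by
          rw [toRat_eq_toInt_mul, toInt_eq_scaledMag_of_nonneg hy0.le]; push_cast; rfl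
        have ht2 : ((2 * t + 1 : ℕ) : ℚ) < 2 ^ (φ.manBits + 2) := by
          exact_mod_cast (show 2 * t + 1 < 2 ^ (φ.manBits + 2) by
            rw [pow_succ 2 (φ.manBits + 1)]; omega)
        have h4 : (y.scaledMag : ℚ) * ψ.quantum
            < ((2 ^ (φ.manBits + 2 + (k + i') + D) : ℕ) : ℚ) * ψ.quantum := by
          rw [← hyQ, hyg]
          calc (((2 * t + 1) * 2 ^ (k + i') : ℕ) : ℚ) * φ.quantum
              = ((2 * t + 1 : ℕ) : ℚ) * (2 ^ (k + i') * φ.quantum) := by push_cast; ring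
            _ < (2 : ℚ) ^ (φ.manBits + 2) * (2 ^ (k + i') * φ.quantum) :=
                mul_lt_mul_of_pos_right ht2 (by positivity)
            _ = ((2 ^ (φ.manBits + 2 + (k + i') + D) : ℕ) : ℚ) * ψ.quantum := by
                rw [hDq]; push_cast; simp only [pow_add]; ring
        have h5 : y.scaledMag < 2 ^ (φ.manBits + 2 + (k + i') + D) := by
          exact_mod_cast lt_of_mul_lt_mul_right h4 hQψ.le
        have h6 := (Nat.pow_lt_pow_iff_right (by norm_num)).mp (h3.trans_lt h5)
        omega
    calc |x - y.toRat| ≤ 2 ^ (y.expCode - 1) * ψ.quantum / 2 := h0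
      _ ≤ 2 ^ (S + 1 + i') * ψ.quantum / 2 := by gcongr; norm_num
      _ = 2 ^ i' * (φ.quantum * φ.quantum) := by rw [hSq, pow_add, pow_succ]; ring
  -- (7) the integers: `x - y = N·quantum φ²`, `N = A·B + C·2^s - (2t+1)·2^(n+i')`,
  -- `0 < |N| ≤ 2^i'`
  obtain ⟨N, hN⟩ : ∃ N : ℤ,
      N = a.toInt * b.toInt + c.toInt * 2 ^ s - (2 * t + 1) * 2 ^ (n + i') := ⟨_, rfl⟩
  have hxy : x - y.toRat = (N : ℚ) * (φ.quantum * φ.quantum) := by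
    have e1 : x = ((a.toInt * b.toInt + c.toInt * 2 ^ s : ℤ) : ℚ) * (φ.quantum * φ.quantum) := by
      rw [hxdef, toRat_eq_toInt_mul, toRat_eq_toInt_mul, toRat_eq_toInt_mul]; push_cast
      linear_combination (-(c.toInt : ℚ) * φ.quantum) * hQq
    have e2 : y.toRat = (((2 * t + 1) * 2 ^ (n + i') : ℤ) : ℚ) * (φ.quantum * φ.quantum) := by
      rw [hyg]; push_cast; rw [pow_add _ n i', pow_add _ k i', ← hkey]; ring
    rw [e1, e2, hN]; push_cast; ring
  have hNle : |N| ≤ 2 ^ i' := by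
    have h2 : |(N : ℚ) * (φ.quantum * φ.quantum)| ≤ 2 ^ i' * (φ.quantum * φ.quantum) := by
      rw [← hxy]; exact habs
    rw [abs_mul, abs_of_pos hqq] at h2
    have h3 : |(N : ℚ)| ≤ 2 ^ i' := le_of_mul_le_mul_right h2 hqq
    exact_mod_cast h3
  have hN0 : N ≠ 0 := by
    intro h0
    apply hxm
    have : x - y.toRat = 0 := by rw [hxy, h0]; simp
    linarith
  -- (8) the sign is forced by the parity of `t`: `|N|·quantum φ² ≤ 2^i'·q² < 2^(k+i')·q`
  have hxg : x = (((2 * t + 1) * 2 ^ (k + i') : ℕ) : ℚ) * φ.quantum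
      + (N : ℚ) * (φ.quantum * φ.quantum) := by
    linarith [hxy]
  have hδ : (2 : ℚ) ^ i' * (φ.quantum * φ.quantum) < 2 ^ (k + i') * φ.quantum := by
    have hq2k : φ.quantum * φ.quantum < 2 ^ k * φ.quantum := by
      apply mul_lt_mul_of_pos_right _ hQφ
      have hQ2 : (2 : ℚ) ≤ 2 ^ s := by
        have : (2:ℚ) ^ 1 ≤ 2 ^ s := pow_le_pow_right₀ (by norm_num) (by omega)
        rwa [pow_one] at this
      have hk1 : (1 : ℚ) ≤ 2 ^ k := one_le_pow₀ (by norm_num)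
      have h2q : 2 * φ.quantum ≤ (2 : ℚ) ^ s * φ.quantum := mul_le_mul_of_nonneg_right hQ2 hQφ.le
      linarith
    calc (2 : ℚ) ^ i' * (φ.quantum * φ.quantum) < 2 ^ i' * (2 ^ k * φ.quantum) :=
          mul_lt_mul_of_pos_left hq2k (by positivity)
      _ = 2 ^ (k + i') * φ.quantum := by rw [pow_add]; ring
  have hNq : |(N : ℚ)| * (φ.quantum * φ.quantum) ≤ 2 ^ i' * (φ.quantum * φ.quantum) := by
    have : |(N : ℚ)| ≤ 2 ^ i' := by exact_mod_cast hNle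
    exact mul_le_mul_of_nonneg_right this hqq.le
  have hσe : Even t → 0 < N := by
    intro hte
    by_contra hle
    push Not at hle
    have hneg : N < 0 := lt_of_le_of_ne hle hN0
    apply h
    have hnq : (N : ℚ) < 0 := by exact_mod_cast hneg
    have hδ0 : (0 : ℚ) < -(N : ℚ) * (φ.quantum * φ.quantum) := mul_pos (neg_pos.mpr hnq) hqq
    have hδ1 : -(N : ℚ) * (φ.quantum * φ.quantum) < 2 ^ (k + i') * φ.quantum := by
      rw [← abs_of_neg hnq]; exact lt_of_le_of_lt hNq hδ
    have hx' : x = (((2 * t + 1) * 2 ^ (k + i') : ℕ) : ℚ) * φ.quantum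
        - -(N : ℚ) * (φ.quantum * φ.quantum) := by
      rw [hxg]; ring
    show (roundNE φ y.toRat).toRat = (roundNE φ x).toRat
    rw [hyg, toRat_roundNE_gmid h1 hte htlo hthi hu1, hx',
      toRat_roundNE_below_gmid htlo hthi hu1 hδ0 hδ1]
  have hσo : Odd t → N < 0 := by
    intro hto
    by_contra hle
    push Not at hle
    have hpos : 0 < N := lt_of_le_of_ne hle (Ne.symm hN0)
    apply h
    have hnq : (0 : ℚ) < N := by exact_mod_cast hpos
    have hδ0 : (0 : ℚ) < (N : ℚ) * (φ.quantum * φ.quantum) := mul_pos hnq hqq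
    have hδ1 : (N : ℚ) * (φ.quantum * φ.quantum) < 2 ^ (k + i') * φ.quantum := by
      rw [← abs_of_pos hnq]; exact lt_of_le_of_lt hNq hδ
    have hx' : x = (((2 * t + 1) * 2 ^ (k + i') : ℕ) : ℚ) * φ.quantum
        + (N : ℚ) * (φ.quantum * φ.quantum) := hxg
    show (roundNE φ y.toRat).toRat = (roundNE φ x).toRat
    rw [hyg, toRat_roundNE_gmid_odd h1 hto htlo hthi hu1, hx',
      toRat_roundNE_above_gmid htlo hthi hu1 hδ0 hδ1]
  -- (9) the shapes of `|A|`, `|B|`, `C` and the range of `C`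
  obtain ⟨-, sa, ja, hsa, hA⟩ := representable_iff.mp (representable_scaledMag a)
  obtain ⟨-, sb, jb, hsb, hB⟩ := representable_iff.mp (representable_scaledMag b)
  obtain ⟨-, sc, jc, hsc, hC⟩ := representable_iff.mp (representable_scaledMag c)
  have hA0 : a.toInt ≠ 0 := fun h0 => ha (by rw [← natAbs_toInt, h0]; rfl)
  have hB0 : b.toInt ≠ 0 := fun h0 => hb0 (by rw [← natAbs_toInt, h0]; rfl)
  have hCM : c.toInt ≤ (2 ^ φ.manBits + J) * 2 ^ (k + i + 1) := by
    have h2 : c.toInt ≤ |c.toInt| := le_abs_self _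
    have h3 : c.toInt.natAbs ≤ (2 ^ φ.manBits + J) * 2 ^ (k + i + 1) := by
      rw [natAbs_toInt, ← hM]; exact scaledMag_le_maxScaled c
    have h4 : ((c.toInt.natAbs : ℕ) : ℤ) ≤ (((2 ^ φ.manBits + J) * 2 ^ (k + i + 1) : ℕ) : ℤ) := by
      exact_mod_cast h3
    rw [Int.natCast_natAbs] at h4
    push_cast at h4
    exact h2.trans h4
  -- (10) the integer core
  exact ladder_core h1 hn2 hks (by omega) hi'i htlo hthi hvis hN hN0 hNle ⟨hσe, hσo⟩
    hsa (by rw [natAbs_toInt]; exact hA) hA0 hsb (by rw [natAbs_toInt]; exact hB) hB0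
    hsc (by rw [natAbs_toInt]; exact hC) hCM

/-! ## §2 The datum of a candidate (completeness, arithmetic half) -/

/-- THE DATUM OF A CANDIDATE.  `bias φ ≥ 1`, `n ≥ m + 2`, `k + m + bias φ = n + 1`,
`M_φ = (2^m + J)·2^(k+i+1)`, `g ≤ i' ≤ i`, `j < 2^m` (any integer `σ`),
`|e| ≤ 2^(2m+2-n-g)`, `w = 2(2^m + j) + 1 - e ≥ 2^m` in range and shaped,
`|e·2^(n+g) + σ·d₁| = a₁·b₁` with `a₁, b₁ < 2^(m+1)`: data `a, b, c` of `φ` with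
`a·b + c = (2(2^m + j) + 1)·2^(k+i')·quantum φ + σ·d₁·2^(i'-g)·quantum φ²` (`a = a₁·2^(i'-g)`,
`b = ±b₁`, `c = w·2^(k+i')` quanta). [this packet] -/
theorem exists_ladder_data {φ : Format} (hb : 1 ≤ φ.bias) {n k i J i' j g d₁ a₁ b₁ : ℕ}
    {e σ : ℤ} (hn2 : φ.manBits + 2 ≤ n) (hk : k + (φ.manBits + φ.bias) = n + 1)
    (hM : φ.maxScaled = (2 ^ φ.manBits + J) * 2 ^ (k + i + 1))
    (hi' : i' ≤ i) (hg : g ≤ i') (hj : j < 2 ^ φ.manBits)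
    (he : |e| ≤ 2 ^ (2 * φ.manBits + 2 - n - g))
    (hw1 : (2 : ℤ) ^ φ.manBits ≤ 2 * (2 ^ φ.manBits + j) + 1 - e)
    (hw2 : (2 * ((2 : ℤ) ^ φ.manBits + j) + 1 - e) * 2 ^ i'
      ≤ (2 ^ φ.manBits + J) * 2 ^ (i + 1))
    (hw3 : fmaShape φ.manBits (2 * ((2 : ℤ) ^ φ.manBits + j) + 1 - e) = true)
    (ha₁ : a₁ < 2 ^ (φ.manBits + 1)) (hb₁ : b₁ < 2 ^ (φ.manBits + 1))
    (hab : (e * 2 ^ (n + g) + σ * d₁).natAbs = a₁ * b₁) :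
    ∃ a b c : MiniFloat φ, a.toRat * b.toRat + c.toRat =
      (((2 * (2 ^ φ.manBits + j) + 1) * 2 ^ (k + i') : ℕ) : ℚ) * φ.quantum
        + (σ : ℚ) * ((d₁ * 2 ^ (i' - g) : ℕ) : ℚ) * (φ.quantum * φ.quantum) := by
  have hkey : (2 : ℚ) ^ n * φ.quantum = 2 ^ k := by
    rw [show n = k + (φ.manBits + (φ.bias - 1)) by omega, pow_add, mul_assoc,
      two_pow_mul_quantum_eq_one hb, mul_one]
  obtain ⟨r, hr⟩ := Nat.exists_eq_add_of_le hg
  have hri : r ≤ i := by omega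
  rw [hr, Nat.add_sub_cancel_left]
  -- `a = a₁·2^r`
  have hMi : 2 ^ (φ.manBits + 1) * 2 ^ i ≤ φ.maxScaled := by
    rw [hM]
    calc 2 ^ (φ.manBits + 1) * 2 ^ i = 2 ^ φ.manBits * 2 ^ (i + 1) := by
          rw [pow_succ, pow_succ]; ring
      _ ≤ (2 ^ φ.manBits + J) * 2 ^ (k + i + 1) :=
          Nat.mul_le_mul (Nat.le_add_right _ _) (Nat.pow_le_pow_right (by norm_num) (by omega))
  have harep : φ.Representable (a₁ * 2 ^ r) :=
    representable_mul_pow ha₁ (le_trans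
      (Nat.mul_le_mul ha₁.le (Nat.pow_le_pow_right (by norm_num) hri)) hMi)
  obtain ⟨a, ha⟩ := exists_toRat_eq_natMul harep
  -- `b = s·b₁` with `s·(a₁·b₁) = e·2^(n+g) + σ·d₁`
  obtain ⟨s, hs, hZ⟩ : ∃ s : ℤ, (s = 1 ∨ s = -1)
      ∧ e * 2 ^ (n + g) + σ * d₁ = s * ((a₁ * b₁ : ℕ) : ℤ) := by
    rcases Int.natAbs_eq (e * 2 ^ (n + g) + σ * d₁) with h0 | h0
    · exact ⟨1, Or.inl rfl, by rw [one_mul, ← hab]; exact h0⟩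
    · exact ⟨-1, Or.inr rfl, by rw [neg_one_mul, ← hab]; exact h0⟩
  have hsb : (s * b₁).natAbs = b₁ := by
    rcases hs with rfl | rfl <;> simp
  have h1M : 2 ^ (φ.manBits + 1) ≤ φ.maxScaled :=
    le_trans (Nat.le_mul_of_pos_right _ (by positivity)) hMi
  obtain ⟨b, hb2⟩ := exists_toRat_eq_intCast_mul (φ := φ) (T := s * b₁)
    (by rw [hsb]; exact representable_of_lt_pow hb₁ (hb₁.le.trans h1M))
  -- `c = w·2^(k+i')`, `w = sc·2^l` shaped
  have h2m : (0 : ℤ) < 2 ^ φ.manBits := by positivity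
  obtain ⟨w, hw⟩ : ∃ w : ℕ, (w : ℤ) = 2 * (2 ^ φ.manBits + j) + 1 - e :=
    ⟨(2 * ((2 : ℤ) ^ φ.manBits + j) + 1 - e).toNat, Int.toNat_of_nonneg (by linarith)⟩
  have hw8 : w < 2 ^ (φ.manBits + 3) := by
    have he1 := (abs_le.mp he).1
    have hE : (2 : ℤ) ^ (2 * φ.manBits + 2 - n - g) ≤ 2 ^ φ.manBits :=
      pow_le_pow_right₀ (by norm_num) (by omega)
    have hjz : (j : ℤ) < 2 ^ φ.manBits := by exact_mod_cast hj
    have h8 : (2 : ℤ) ^ (φ.manBits + 3) = 2 ^ φ.manBits * 8 := by rw [pow_add]; norm_num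
    have : (w : ℤ) < 2 ^ (φ.manBits + 3) := by rw [hw, h8]; linarith
    exact_mod_cast this
  obtain ⟨sc, l, hwsl, hsc⟩ := exists_of_fmaShape (by rw [hw]; exact hw3) hw8
  have hcle : w * 2 ^ (k + (g + r)) ≤ φ.maxScaled := by
    have h2 : ((w * 2 ^ (g + r) : ℕ) : ℤ) ≤ (((2 ^ φ.manBits + J) * 2 ^ (i + 1) : ℕ) : ℤ) := by
      push_cast; rw [hw, ← hr]; exact hw2
    have h3 : w * 2 ^ (g + r) ≤ (2 ^ φ.manBits + J) * 2 ^ (i + 1) := by exact_mod_cast h2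
    rw [hM, show k + i + 1 = (i + 1) + k by omega, pow_add _ (i + 1) k, ← mul_assoc,
      show k + (g + r) = (g + r) + k by omega, pow_add _ (g + r) k, ← mul_assoc]
    exact Nat.mul_le_mul_right _ h3
  have hcrep : φ.Representable (w * 2 ^ (k + (g + r))) := by
    have e1 : w * 2 ^ (k + (g + r)) = sc * 2 ^ (l + (k + (g + r))) := by rw [hwsl, pow_add]; ring
    rw [e1] at hcle ⊢; exact representable_mul_pow hsc hcle
  obtain ⟨c, hc⟩ := exists_toRat_eq_natMul hcrep
  -- the sum
  have hZq : (e : ℚ) * 2 ^ (n + g) + σ * d₁ = s * (a₁ * b₁) := by exact_mod_cast hZ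
  have hwq : (w : ℚ) = 2 * (2 ^ φ.manBits + j) + 1 - e := by exact_mod_cast hw
  refine ⟨a, b, c, ?_⟩
  rw [ha, hb2, hc]
  push_cast
  linear_combination (-(2 : ℚ) ^ r * (φ.quantum * φ.quantum)) * hZq
    + ((2 : ℚ) ^ (k + (g + r)) * φ.quantum) * hwq + ((e : ℚ) * 2 ^ (g + r) * φ.quantum) * hkey

end Summit.Ventures.CertifiedArithmetic
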